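import Mathlib
import Summits.KontsevichZagierPeriods.KontsevichZagierPeriods.Theorems.CompiledSubstitutionsPiNormalisation
import Summits.KontsevichZagierPeriods.KontsevichZagierPeriods.Theorems.ComplexOrientationsOvalSectorDiscSector
import Summits.KontsevichZagierPeriods.KontsevichZagierPeriods.Theorems.GammaHodgeSector.Negative.Calibration
import Literature.NumberTheory.Transcendental.KZRelationsLE
import Literature.NumberTheory.Transcendental.KZDilationMove
import Literature.NumberTheory.Transcendental.KZSemiCanonicalReductionProofs

/-!
# Crux `TypeOneIdentities` (stmt-KontsevichZagierPeriods-11368), line `birth`, stub D `stub_carrierDiscCalibration`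

Curve-free disc bookkeeping of the registered skeleton `Lines/birth.lean` of the crux
`ComplexOrientations.TypeOneIdentities`: for a real algebraic `a` and the one-dimensional
"`2π`-carrier" `r = [ℝ, a/(1+s²)]` (value `aπ`) there are a unit sign `ε` (`= 1` if `a ≥ 0`, `= −1`
if `a < 0`) and `β = |a|` such that `ε·[r] − [e] ∈ KZ.relations` for EVERY integrand-`1`
representation `e` of the open disc `{v 0 ² + v 1 ² < β}`.

The chain (Kontsevich–Zagier 2001, §1.1 eq. (1), §1.2 rules (1), (2)), assembled from landed moves:

* `[ℝ, 1/(1+s²)] ∼ [closed unit disc, 1]` is `PiNormalisation` (stmt-3384,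
  `CompiledSubstitutions.PiNormalisation.piNormalisation_proof`), applied to `a⁻¹ · r`;
* `[closed unit disc, 1] ∼ [open unit disc, 1]` (the null unit circle, rule (1a)) is
  `GammaHodgeSectorNegative.equivalent_piRep_discRep`;
* the scaling endomorphism `KZ.scale a` (`KZ.Equivalent.constMul`) then gives
  `[ℝ, a/(1+s²)] ∼ [open unit disc, a]`;
* one rule-(2) dilation by `√β` turns `[open unit disc, β]` into `[open disc of radius √β, 1]`
  (`ComplexOrientations.OvalSector.of_disc_sub_of_constMul_mem_relations` of the sister crux
  `OvalSector`, via `KZ.smul_sub_mem_relations`);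
* for `a < 0`, `[D, a] + [D, −a]` is a rule-(1b) relation (`KZ.of_add_of_mem_relations_of_eqOn_neg`).

No definitions are introduced.
-/

noncomputable section

open MeasureTheory Set
open Literature.NumberTheory.Transcendental
open Summit.KontsevichZagierPeriods.GammaHodgeSectorNegative (discRep equivalent_piRep_discRep)

namespace Summit.KontsevichZagierPeriods.ComplexOrientations.TypeOneIdentities

/-- **The carrier is the open unit disc with the constant integrand `a`.** For real algebraic `a` and
the carrier `r = [ℝ, a/(1+s²)]`: `[r] − [D, a] ∈ KZ.relations`, where `D = discRep = [open unit disc, 1]`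
and `[D, a] = D.constMul a`. For `a ≠ 0`: `a⁻¹ · r` has integrand `1/(1+s²)`, so `PiNormalisation`
(stmt-3384) and `equivalent_piRep_discRep` (closed versus open unit disc, null circle) give
`a⁻¹ · r ∼ [D, 1]`, and the scaling endomorphism (`KZ.Equivalent.constMul a`) gives `r ∼ [D, a]` up
to the congruence `a · (a⁻¹ · r) ≡ r` (`KZ.of_sub_of_mem_relations_of_eqOn`); for `a = 0` both
representations have the zero integrand (`KZ.of_mem_relations_of_eqOn_zero`).
[cite: KontsevichZagier2001, §1.1 eq. (1)] -/
theorem carrier_sub_constMul_discRep_mem_relations (a : ℝ) (ha : IsAlgebraic ℚ a)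
    (r : KZ.IntegralRep 1) (hrd : r.domain = univ)
    (hri : ∀ z : Fin 1 → ℝ, r.integrand z = a / (1 + (z 0) ^ 2)) :
    KZ.of r - KZ.of (discRep.constMul a ha) ∈ KZ.relations := by
  by_cases ha0 : a = 0
  · subst ha0
    refine KZ.relations.sub_mem (KZ.of_mem_relations_of_eqOn_zero r fun z _ => ?_)
      (KZ.of_mem_relations_of_eqOn_zero _ fun x _ => ?_)
    · simp only [hri z, zero_div, Pi.zero_apply]
    · simp
  · -- `a⁻¹ · r = [ℝ, 1/(1+s²)] ∼ [closed unit disc, 1]` (PiNormalisation)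
    have h1 : KZ.Equivalent (r.constMul a⁻¹ ha.inv) KZ.piRep :=
      (Summit.KontsevichZagierPeriods.CompiledSubstitutions.PiNormalisation.piNormalisation_proof
        KZ.piRep rfl fun _ _ => rfl).1 (r.constMul a⁻¹ ha.inv) hrd fun x _ => by
          simp only [KZ.IntegralRep.integrand_constMul, hri x]
          rw [mul_div_assoc', inv_mul_cancel₀ ha0]
    -- `∼ [open unit disc, 1]` (null circle), then scale everything by `a`
    have h2 : KZ.Equivalent ((r.constMul a⁻¹ ha.inv).constMul a ha) (discRep.constMul a ha) :=
      KZ.Equivalent.constMul a ha (h1.trans equivalent_piRep_discRep)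
    -- `r ≡ a · (a⁻¹ · r)` (same domain, same integrand)
    have h0 : KZ.Equivalent r ((r.constMul a⁻¹ ha.inv).constMul a ha) :=
      KZ.of_sub_of_mem_relations_of_eqOn rfl fun x _ => by
        simp only [KZ.IntegralRep.integrand_constMul]
        rw [mul_inv_cancel_left₀ ha0]
    exact h0.trans h2

/-- **Stub D — `carrierDiscCalibration` (disc bookkeeping for the `2π`-carriers; curve-free).**
For real algebraic `a` and the one-dimensional carrier `r = [ℝ, a/(1+s²)]` (value `aπ`) there are a
unit sign `ε` and a real algebraic `β ≥ 0` (namely `ε = 1, β = a` if `a ≥ 0` and `ε = −1, β = −a` if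
`a < 0`) with `ε·[r] − [e] ∈ KZ.relations` for EVERY integrand-`1` representation `e` of the open disc
`{x² + y² < β}`: `[r] ∼ [D, a]` (`carrier_sub_constMul_discRep_mem_relations`: `PiNormalisation`, the
null unit circle, the scaling endomorphism), `[e] ∼ [D, β]` by one rule-(2) dilation
(`OvalSector.of_disc_sub_of_constMul_mem_relations`), and for `a < 0` the rule-(1b) relation
`[D, a] + [D, −a]` (`KZ.of_add_of_mem_relations_of_eqOn_neg`), with `D = discRep` the integrand-`1`
representation of the open unit disc. [cite: KontsevichZagier2001, §1.1 eq. (1), §1.2 rules (1), (2)] -/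
theorem stub_carrierDiscCalibration :
    ∀ (a : ℝ) (r : Literature.NumberTheory.Transcendental.KZ.IntegralRep 1), IsAlgebraic ℚ a → r.domain = Set.univ → (∀ z : Fin 1 → ℝ, r.integrand z = a / (1 + (z 0) ^ 2)) → ∃ (ε : ℤ) (β : ℝ), (ε = 1 ∨ ε = -1) ∧ IsAlgebraic ℚ β ∧ 0 ≤ β ∧ ∀ e : Literature.NumberTheory.Transcendental.KZ.IntegralRep 2, e.domain = {v : Fin 2 → ℝ | v 0 ^ 2 + v 1 ^ 2 < β} → (∀ v ∈ e.domain, e.integrand v = 1) → ε • Literature.NumberTheory.Transcendental.KZ.of r - Literature.NumberTheory.Transcendental.KZ.of e ∈ Literature.NumberTheory.Transcendental.KZ.relations := by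
  intro a r ha hrd hri
  have hD : discRep.domain = {v : Fin 2 → ℝ | v 0 ^ 2 + v 1 ^ 2 < 1} := rfl
  have hD1 : ∀ v ∈ discRep.domain, discRep.integrand v = 1 := fun _ _ => rfl
  have hr : KZ.of r - KZ.of (discRep.constMul a ha) ∈ KZ.relations :=
    carrier_sub_constMul_discRep_mem_relations a ha r hrd hri
  rcases le_or_gt 0 a with ha0 | ha0
  · -- `a ≥ 0`: `ε = 1`, `β = a`
    refine ⟨1, a, Or.inl rfl, ha, ha0, fun e hed hei => ?_⟩
    have he : KZ.of e - KZ.of (discRep.constMul a ha) ∈ KZ.relations :=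
      OvalSector.of_disc_sub_of_constMul_mem_relations a ha ha0 e discRep hed hei hD hD1
    have h : (1 : ℤ) • KZ.of r - KZ.of e =
        (KZ.of r - KZ.of (discRep.constMul a ha)) - (KZ.of e - KZ.of (discRep.constMul a ha)) := by
      rw [one_smul]
      abel
    rw [h]
    exact KZ.relations.sub_mem hr he
  · -- `a < 0`: `ε = -1`, `β = -a`
    have hna : IsAlgebraic ℚ (-a) := ha.neg
    have hb0 : 0 ≤ -a := (neg_pos.mpr ha0).le
    refine ⟨-1, -a, Or.inr rfl, hna, hb0, fun e hed hei => ?_⟩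
    have he : KZ.of e - KZ.of (discRep.constMul (-a) hna) ∈ KZ.relations :=
      OvalSector.of_disc_sub_of_constMul_mem_relations (-a) hna hb0 e discRep hed hei hD hD1
    have hpm : KZ.of (discRep.constMul a ha) + KZ.of (discRep.constMul (-a) hna) ∈ KZ.relations :=
      KZ.of_add_of_mem_relations_of_eqOn_neg rfl fun x _ => by
        simp only [KZ.IntegralRep.integrand_constMul, Pi.neg_apply, neg_mul]
    have h : (-1 : ℤ) • KZ.of r - KZ.of e =
        -(KZ.of r - KZ.of (discRep.constMul a ha)) - (KZ.of e - KZ.of (discRep.constMul (-a) hna)) -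
          (KZ.of (discRep.constMul a ha) + KZ.of (discRep.constMul (-a) hna)) := by
      rw [neg_one_zsmul]
      abel
    rw [h]
    exact KZ.relations.sub_mem (KZ.relations.sub_mem (KZ.relations.neg_mem hr) he) hpm

end Summit.KontsevichZagierPeriods.ComplexOrientations.TypeOneIdentities

end
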